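import Summits.CriticalPhenomena.PercolationContinuityZ3.Theorems.PercNearOneGluingNoHeavyLowerTailSahiCombTriWUncrossing
import Summits.CriticalPhenomena.PercolationContinuityZ3.Theorems.PercNearOneGluingNoHeavyLowerTailSahiCombTriWAntiNested

/-!
# NORMAL FORM of the generic `a = 2` case of `TRI_W`: uncrossed AN♯3 part + Kleitman gaps + shells + the two crossing terms

Support file of the one-cut programme (crux `NoHeavyLowerTail`, stmt-CriticalPhenomena-4575; TRI lane of cell `prim-masterthm`; seat prim-lf-1 gen 38,
memo `FROM-prim-lf-1-gen38-AN3-KERNEL.md` §6).  Composition of the uncrossing identity (`…TriWUncrossing.triW_uncross_eq`, this seat) with the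
anti-nested identity (`…TriWAntiNested.triWOne_antiNested_eq`, prim-lf-1 gen 37) for the uncrossed chains
`Φ = (F ∅ ⊆ M_F ⊆ J_F ⊆ F univ)`, `Γ = (G ∅ ⊆ M_G ⊆ J_G ⊆ G univ)`, `M = F{a} ∩ F{b}`, `J = F{a} ∪ F{b}`:

* `FiveUpSet.triWOne_swap_pairs` — `triWOne(P;A,A';B,B') = triWOne(P;A',A;B',B)`;
* **`FiveUpSet.triW_eq_uncrossed_normalForm`** — for every two-atom index cube, monotone `F, G` and any `P`:
  `triW P F G = [antiNestedSupply − antiNestedDemand](P;Φ;Γ) + Kl_{P∩M_G}(M_F) + Kl_{P∩M_F}(M_G) + Kl_{P∩G ∅}(F univ) + (six shells of Φ × Γ)`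
  `+ X(F{a}∖F{b}, G{a}∖G{b}) + X(F{b}∖F{a}, G{b}∖G{a})`,  `X(U,V) = 2#(P∩U∩V) + #(P∩refl U∩V) + #(P∩U∩refl V) − 2#(P∩refl U∩refl V)`.
For up-sets every term is `≥ 0` (AN♯3 = `antiNestedChainHall_holds`, Kleitman, cardinalities) EXCEPT `−2#(P ∩ refl D_a) − 2#(P ∩ refl D_b)`
(`D_a = (F{a}∖F{b}) ∩ (G{a}∖G{b})`, `D_b` likewise: the cells of shell weight 2).  So the open statement `ChainTwoIneq` (= `TriWIneq` at `a = 2`) is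
EXACTLY the absorption of the two reflected double-crossing counts by the AN♯3 slack of the uncrossed chains and the listed spare terms
(census prim-lf-1 gen 38: the AN♯3 slack cannot be dropped; the three gaps + shells rarely matter).
HONEST LABEL: an exact identity assembling two tree identities; no new inequality. [this work]
-/

namespace Summit.CriticalPhenomena.PercolationContinuityZ3.Theorems

namespace FiveUpSet

open Finset LatticeFiveUpSet

variable {γ : Type} [DecidableEq γ] [Fintype γ]

/-! ### The normal form of the generic `a = 2` case -/

/-- Swapping both pairs leaves the thin-edge functional unchanged. [this work] -/
theorem triWOne_swap_pairs (P A A' B B' : Finset (Finset γ)) :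
    triWOne (complEquiv γ) P A A' B B' = triWOne (complEquiv γ) P A' A B' B := by
  unfold triWOne; ring

/-- **NORMAL FORM OF `TRI_W(2)` (generic configuration).**  For a two-atom index cube `univ = {a,b}`, monotone families `F, G` and any `P`, with the
uncrossed chains `Φ = (F ∅ ⊆ M_F ⊆ J_F ⊆ F univ)`, `Γ = (G ∅ ⊆ M_G ⊆ J_G ⊆ G univ)` (`M = F{a} ∩ F{b}`, `J = F{a} ∪ F{b}`):
`triW P F G = [antiNestedSupply − antiNestedDemand](P;Φ;Γ) + Kl_{P∩M_G}(M_F) + Kl_{P∩M_F}(M_G) + Kl_{P∩G∅}(F univ) + (six shells of Φ × Γ) + X_a + X_b`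
(`triW_uncross_eq` + `triWOne_antiNested_eq`).  Every term is `≥ 0` for up-sets (AN♯3 = `antiNestedChainHall_holds`, Kleitman, cardinalities) EXCEPT the two
reflected double-crossing counts `−2·#(P ∩ refl D_a)`, `−2·#(P ∩ refl D_b)` inside `X_a, X_b`: the open part of `TriWIneq` at `a = 2` (`ChainTwoIneq`) is exactly their
absorption. [this work] -/
theorem triW_eq_uncrossed_normalForm {β : Type} [DecidableEq β] [Fintype β] {a b : β} (hab : a ≠ b) (hu : (univ : Finset β) = {a, b})
    (P : Finset (Finset γ)) (F G : Finset β → Finset (Finset γ)) (hFm : Monotone F) (hGm : Monotone G) :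
    triW P F G
      = (((antiNestedSupply P (F ∅) (F {a} ∩ F {b}) (F {a} ∪ F {b}) (F univ) (G ∅) (G {a} ∩ G {b}) (G {a} ∪ G {b}) (G univ) : ℤ)
            - antiNestedDemand P (F ∅) (F {a} ∩ F {b}) (F {a} ∪ F {b}) (F univ) (G ∅) (G {a} ∩ G {b}) (G {a} ∪ G {b}) (G univ))
          + (((P ∩ (F {a} ∩ F {b}) ∩ (G {a} ∩ G {b})).card : ℤ) - (P ∩ refl (F {a} ∩ F {b}) ∩ (G {a} ∩ G {b})).card)
          + (((P ∩ (F {a} ∩ F {b}) ∩ (G {a} ∩ G {b})).card : ℤ) - (P ∩ (F {a} ∩ F {b}) ∩ refl (G {a} ∩ G {b})).card)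
          + (((P ∩ F univ ∩ G ∅).card : ℤ) - (P ∩ refl (F univ) ∩ G ∅).card)
          + ((P ∩ ((F {a} ∩ F {b}) \ F ∅) ∩ ((G {a} ∩ G {b}) \ G ∅)).card + (P ∩ ((F {a} ∩ F {b}) \ F ∅) ∩ ((G {a} ∪ G {b}) \ (G {a} ∩ G {b}))).card
              + (P ∩ ((F {a} ∪ F {b}) \ (F {a} ∩ F {b})) ∩ ((G {a} ∩ G {b}) \ G ∅)).card
              + (P ∩ (F univ \ (F {a} ∪ F {b})) ∩ ((G {a} ∩ G {b}) \ G ∅)).card + (P ∩ (F univ \ (F {a} ∪ F {b})) ∩ ((G {a} ∪ G {b}) \ (G {a} ∩ G {b}))).card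
              + (P ∩ (F univ \ (F {a} ∪ F {b})) ∩ (G univ \ (G {a} ∪ G {b}))).card : ℕ))
        + (2 * ((P ∩ (F {a} \ F {b}) ∩ (G {a} \ G {b})).card : ℤ) + (P ∩ refl (F {a} \ F {b}) ∩ (G {a} \ G {b})).card
            + (P ∩ (F {a} \ F {b}) ∩ refl (G {a} \ G {b})).card - 2 * ((P ∩ refl (F {a} \ F {b}) ∩ refl (G {a} \ G {b})).card : ℤ))
        + (2 * ((P ∩ (F {b} \ F {a}) ∩ (G {b} \ G {a})).card : ℤ) + (P ∩ refl (F {b} \ F {a}) ∩ (G {b} \ G {a})).card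
            + (P ∩ (F {b} \ F {a}) ∩ refl (G {b} \ G {a})).card - 2 * ((P ∩ refl (F {b} \ F {a}) ∩ refl (G {b} \ G {a})).card : ℤ)) := by
  have cF1 : F ∅ ⊆ F {a} ∩ F {b} := subset_inter (hFm (empty_subset _)) (hFm (empty_subset _))
  have cF2 : F {a} ∩ F {b} ⊆ F {a} ∪ F {b} := inter_subset_left.trans subset_union_left
  have cF3 : F {a} ∪ F {b} ⊆ F univ := union_subset (hFm (subset_univ _)) (hFm (subset_univ _))
  have cG1 : G ∅ ⊆ G {a} ∩ G {b} := subset_inter (hGm (empty_subset _)) (hGm (empty_subset _))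
  have cG2 : G {a} ∩ G {b} ⊆ G {a} ∪ G {b} := inter_subset_left.trans subset_union_left
  have cG3 : G {a} ∪ G {b} ⊆ G univ := union_subset (hGm (subset_univ _)) (hGm (subset_univ _))
  have hid := triWOne_antiNested_eq P (F ∅) (F {a} ∩ F {b}) (F {a} ∪ F {b}) (F univ) (G ∅) (G {a} ∩ G {b}) (G {a} ∪ G {b}) (G univ)
    cF1 cF2 cF3 cG1 cG2 cG3
  rw [triW_eq_pairSum hab hu P F G, triWOne_uncross_eq P (F {a}) (F {b}) (G {a}) (G {b}), triWOne_swap_pairs P (F {a} ∩ F {b})]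
  linarith [hid]

end FiveUpSet

end Summit.CriticalPhenomena.PercolationContinuityZ3.Theorems
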